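import Literature.IUT.HodgeTheaters.PiAvatarEvalSectionsOuterIsoGeometricAmbiguity
import Literature.IUT.HodgeTheaters.InitialThetaDataDecompAtRelativelySlim
import HarnessLib

/-!
# [IUTchI] Examples 4.4 (ii) / 4.5 (i) (bad place) WITH THE GEOMETRIC AMBIGUITY, AT THE PARAMETRIC BAD-PAIR Θ-KIT — the
# `hZ : Z_{G_F}(G_K ∩ G_v̲) = 1` binder ELIMINATED (proof-only knit)

`Proofs` companion (theorems only: no `def`, no `instance`, no notation, no `Prop` fact, no `sorry`) for the cell abc-iut, layer L5,
seat abc-iut-L5-t3 (gen 10), self-row «HZ-DECOMPAT-RELSLIM», knit step.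

S. Mochizuki, *Inter-universal Teichmüller theory I*, Example 4.4 (ii) p. 107 («the natural outer action `Π_v̲ ↠ G_v̲` … compatible … up to
a finite ambiguity»), Example 4.5 (i) (the bad-place clause), Def. 3.1 (e) pp. 62–63 [claim: Mochizuki2012, status: disputed]; S. Mochizuki,
[AbsAnab] (2004) Thm. 1.1.1 (ii) p. 6 (relative slimness of `G_𝔭 ↪ G_F`, FACT-LIST F-0029, PROVED in the tree) [cite: MochizukiAbsAnab2004, Thm 1.1.1 (ii) p.6].

abc-iut-L5-t3's `InitialThetaData.outerAction_compatible_geometricAmbiguity_thetaOfBadPairs` (p496228) carried, besides the kit binders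
{`CG`, `hS`, `M`, `hA`, `hI`} ∪ {`B`, `ΛBad`} ∪ {`ES`}, ONE displayed binder `hZ : Z_{G_F}(Gv v̲) = 1` = `Z_{G_F}(G_K ∩ G_v̲) = 1`
(`gv_eq_galoisSubgroupOf_inf_decompAt`).  `InitialThetaDataDecompAtRelativelySlim` proved it
(`centralizer_galoisSubgroupOf_inf_decompAt_eq_bot_of_mem_indexCopyBad`).  This file knits:

* `InitialThetaData.centralizer_gv_eq_bot_of_evalSectionBinder` — for the evaluation-section binder family `ES` of the parametric bad-pair
  Θ-kit, `Z_{G_F}(Gv v̲) = 1` at every `v̲ ∈ V̲^bad` (a THEOREM, no hypothesis);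
* **`InitialThetaData.outerAction_compatible_geometricAmbiguity_thetaOfBadPairs_of_evalSectionBinder`** — the p496228 statement VERBATIM
  with `hZ` removed: displayed binders EXACTLY the kit's {`CG`, `hS`, `M`, `hA`, `hI`} ∪ {`B`, `ΛBad`} ∪ {`ES`}.

Universe: `F K F̄ : Type` (the universe of the kit of record; the MLF slimness fact is stated there).  HONEST FRAMING: the geometric-ambiguity
bracket is OUR reading of Ex. 4.4 (ii) over OUR Π-avatar kit; finiteness of `N_{Δ_{C_F}}(Π_v̲)/Δ_v̲` ([SemiAnbd] Thm 6.4) is NOT asserted; no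
token moves by this file alone; nothing here asserts that abc is proved or refuted or takes a side on [IUTchIII] Cor. 3.12; typed ≠ inhabited
≠ discharged.
-/

namespace Literature.IUT.HodgeTheaters

open CategoryTheory

section Unconditional

variable {F K Fbar : Type} [Field F] [NumberField F] [Field K] [NumberField K]
  [Algebra F K] [Field Fbar] [Algebra F Fbar] [Algebra K Fbar]
  {E : WeierstrassCurve F} [E.IsElliptic] {l : ℕ} {Pb : BadPlacePredicates K}
  (D : InitialThetaData F K Fbar E l Pb) (CG : D.geom.pe.CuspGalois) (hS : D.CuspClassesNormaliserStable) [Fact l.Prime]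

namespace InitialThetaData

variable (M : D.TorsionMonodromy) (hA : D.geom.pe.ArrowCoveringClaims)
  (hI : ∀ k ∈ D.geom.pe.inertia D.geom.pe.ε1, M.tau (D.geom.embK k) = 0)
  (B : ∀ v, v ∈ D.indexCopyBad → D.BadPairAt v) (ΛBad : ∀ v (h : v ∈ D.indexCopyBad), D.LocalArrowLaw CG hS (B v h).H)
  {Gv : D.IndexCopy → Subgroup (Fbar ≃ₐ[F] Fbar)}
  (ES : ∀ v, v ∈ D.indexCopyBad → EvalSectionBinder (D.localDataOfBadPairs CG hS M hA hI B ΛBad v) (Gv v))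

include ES in
/-- **`Z_{G_F}(Gv v̲) = 1` for the group of the evaluation-section binder at every bad index** — `Gv v̲ = G_K ∩ G_v̲`
(`gv_eq_galoisSubgroupOf_inf_decompAt`) and [AbsAnab] Thm 1.1.1 (ii) at the Def 3.1 (e) datum
(`centralizer_galoisSubgroupOf_inf_decompAt_eq_bot_of_mem_indexCopyBad`). ([IUTchI] Def 3.1 (e) p.62) [claim: Mochizuki2012, status: disputed] -/
theorem centralizer_gv_eq_bot_of_evalSectionBinder {v : D.IndexCopy} (hv : v ∈ D.indexCopyBad) :
    Subgroup.centralizer ((Gv v : Subgroup (Fbar ≃ₐ[F] Fbar)) : Set (Fbar ≃ₐ[F] Fbar)) = ⊥ := by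
  rw [D.gv_eq_galoisSubgroupOf_inf_decompAt CG hS M hA hI B ΛBad ES hv]
  exact D.centralizer_galoisSubgroupOf_inf_decompAt_eq_bot_of_mem_indexCopyBad hv

/-- **Examples 4.4 (ii) / 4.5 (i) (bad place) WITH THE GEOMETRIC AMBIGUITY, AT THE PARAMETRIC BAD-PAIR Θ-KIT — `hZ` ELIMINATED.**
DISPLAYED binders EXACTLY {`CG`, `hS`, `M`, `hA`, `hI`} ∪ {`B`, `ΛBad`} ∪ {`ES`}: for every constituent `g` of
`(D.multKitThetaNFOfBadPairs CG hS M hA hI B ΛBad ES).thetaPolyBad j v hv` and every representative `ψ` of `g.out`, an admissible `a ∈ N(Π_v̲)`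
exists, the admissible elements are EXACTLY `N_{Δ_{C_F}}(Π_v̲)·a` (the ambiguity of the outer isomorphism of `π₁^geo` is purely geometric), `ψ`
kills `π₁^geo`, and every element of `N(Π_v̲)` has slope class `1` — p496228's statement verbatim, its `hZ` now supplied by
`centralizer_gv_eq_bot_of_evalSectionBinder`. ([IUTchI] Ex 4.4 (ii) p.107) [claim: Mochizuki2012, status: disputed] -/
theorem outerAction_compatible_geometricAmbiguity_thetaOfBadPairs_of_evalSectionBinder {v : D.IndexCopy} (hv : v ∈ D.indexCopyBad)
    (j : Fin (lStar l))
    {g : (D.baseKitThetaNFOfBadPairs CG hS M hA hI B ΛBad).model v ⟶ (D.baseKitThetaNFOfBadPairs CG hS M hA hI B ΛBad).model v}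
    (hg : g ∈ (D.multKitThetaNFOfBadPairs CG hS M hA hI B ΛBad ES).thetaPolyBad j v hv)
    (ψ : ↥(D.localDataOfBadPairs CG hS M hA hI B ΛBad v).H →* ↥(D.localDataOfBadPairs CG hS M hA hI B ΛBad v).H)
    (hψ : OuterHom.ofHom ψ = g.out) :
    ∃ (a : D.PiC) (ha : a ∈ Subgroup.normalizer (((D.localDataOfBadPairs CG hS M hA hI B ΛBad v).H : Subgroup D.PiC) : Set D.PiC)),
      (∀ g' : ↥(D.localDataOfBadPairs CG hS M hA hI B ΛBad v).H, ∃ d : ↥(D.localDataOfBadPairs CG hS M hA hI B ΛBad v).H,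
        (d : D.PiC) ∈ D.DeltaC ∧ (ψ g' : D.PiC) = a⁻¹ * g' * a * d) ∧
      (∀ a' : D.PiC,
        (a' ∈ Subgroup.normalizer (((D.localDataOfBadPairs CG hS M hA hI B ΛBad v).H : Subgroup D.PiC) : Set D.PiC) ∧
            ∀ g' : ↥(D.localDataOfBadPairs CG hS M hA hI B ΛBad v).H, ∃ d : ↥(D.localDataOfBadPairs CG hS M hA hI B ΛBad v).H,
              (d : D.PiC) ∈ D.DeltaC ∧ (ψ g' : D.PiC) = a'⁻¹ * g' * a' * d) ↔
          (a' * a⁻¹ ∈ Subgroup.normalizer (((D.localDataOfBadPairs CG hS M hA hI B ΛBad v).H : Subgroup D.PiC) : Set D.PiC) ∧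
            a' * a⁻¹ ∈ D.DeltaC)) ∧
      (∀ x : ↥(D.localDataOfBadPairs CG hS M hA hI B ΛBad v).H, (x : D.PiC) ∈ D.DeltaC → ψ x = 1) ∧
      D.slopeStar CG hS ⟨a, (D.localDataOfBadPairs CG hS M hA hI B ΛBad v).law.normalizer_le ha⟩ = 1 ∧
      ∀ (a' : D.PiC) (ha' : a' ∈ Subgroup.normalizer (((D.localDataOfBadPairs CG hS M hA hI B ΛBad v).H : Subgroup D.PiC) : Set D.PiC)),
        D.slopeStar CG hS ⟨a', (D.localDataOfBadPairs CG hS M hA hI B ΛBad v).law.normalizer_le ha'⟩ = 1 :=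
  D.outerAction_compatible_geometricAmbiguity_thetaOfBadPairs CG hS M hA hI B ΛBad ES hv
    (D.centralizer_gv_eq_bot_of_evalSectionBinder CG hS M hA hI B ΛBad ES hv) j hg ψ hψ

end InitialThetaData

end Unconditional

end Literature.IUT.HodgeTheaters
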